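import Summits.HubbardSuperconductivity.HubbardSuperconductivity.Theorems.AnisotropyChordTransferFibre3TwoHoleBS

/-!
# Route `AnisotropyChord` / H0 rotor rung: PROP BS is SHARP — the finite Green-matrix criterion is EQUIVALENT to `TwoHoleGap` at fixed `L` (necessity half), and monotonicity in `g`

Sixth file of PROP BS (memo ROTOR-THEORY-19 §253; memo 21 §314(a); theory seat `hubbard-h0-rotor-theory-1`).  `…Fibre3TwoHoleBS`
proved SUFFICIENCY: per-pair dual / matrix certificates ⇒ `TwoHoleGap L g`.  This file proves the converse direction, so that
the per-L certificates of the memo's tables (§314(c), §319, §330) lose nothing: if `TwoHoleGap L g` holds then every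
POTENTIAL `G̃_g c` of a charge `c` that vanishes on the pair satisfies the certificate inequality with equality of energies —
* `pot` (`(G̃_g c)(x) = Σ_y G̃_g(x−y) c y`), `ft_greenW`, `ft_pot` (`(G̃c)^(k) = [k≠0] ĉ(k)/(ε(k)−g)`), `sum_pot` (zero mean),
  `energy_pot` (`E[G̃c] − g‖G̃c‖² = Re Γ_g(c)`, `g < ε₁`);
* ★ `greenQF_ge_of_twoHoleGap`: `TwoHoleGap L g ⇒ ½(Σ_e‖G̃c(z₁+e)‖² + Σ_e‖G̃c(z₂+e)‖²) ≤ Re Γ_g(c)` whenever `G̃c` vanishes at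
  `z₁, z₂`; ★ `greenMat_form_ge_of_twoHoleGap`: the same on the ten slots — `½Σ_p‖(G̃_DD w)_p‖² ≤ Re wᴴG̃_DD w` for every charge
  vector `w` with `(G̃_DD w)` vanishing at the two centres, i.e. `[(G̃_DD)⁻¹]_{BB} − ½N ⪰ 0` when `G̃_DD` is invertible (the
  hypothesis of `matrixCert_of_inverse`): the criterion is an EQUIVALENCE;
* `twoHoleGap_of_nonpos` (trivial for `g ≤ 0`; monotonicity in `g` is p1's `twoHoleGap_mono` in `…Fibre3TwoHoleGapReduce`).
Prover seat `hubbard-h0-rotor-p2` g2; helper for stmt-HubbardSuperconductivity-19089 (`--supports`, helper class).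
WHAT THIS IS NOT: nothing here proves superconductivity in the Hubbard model; the rotor TARGET as originally worded stays
FALSE (g15 verdict).  Bookkeeping for ONE input (HOLE₂) of ONE conditional reduction (rung 19089).  Mathlib + tree imports only;
no sorry, no axioms.
-/

set_option linter.dupNamespace false

noncomputable section

open scoped BigOperators
open Complex Finset

namespace Summit.HubbardSuperconductivity.HubbardSuperconductivity.Theorems.AnisotropyChord.Transfer.Fibre3

namespace TwoHoleBS

variable (L : ℕ) [NeZero L]

/-! ## Sharpness: the finite criterion loses nothing (necessity half of PROP BS) -/

/-- `TwoHoleGap L g` is trivial for `g ≤ 0`. [folklore] -/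
theorem twoHoleGap_of_nonpos {g : ℝ} (hg : g ≤ 0) : TwoHoleGap L g := by
  intro z₁ z₂ _ f _
  have h0 : 0 ≤ ∑ x : Tor L, (if (x = z₁ ∨ x = z₂) then (0 : ℝ) else ‖f x‖ ^ 2) :=
    Finset.sum_nonneg fun x _ => by split_ifs <;> positivity
  have h1 : 0 ≤ (1 / 4 : ℝ) * ∑ x : Tor L, ((nnList L).map (fun e =>
      if (x = z₁ ∨ x = z₂ ∨ x + e = z₁ ∨ x + e = z₂) then (0 : ℝ) else ‖f x - f (x + e)‖ ^ 2)).sum := by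
    refine mul_nonneg (by norm_num) (Finset.sum_nonneg fun x _ => ?_)
    rw [nnList_map_sum]
    have : ∀ e : Tor L, 0 ≤ (if (x = z₁ ∨ x = z₂ ∨ x + e = z₁ ∨ x + e = z₂) then (0 : ℝ) else ‖f x - f (x + e)‖ ^ 2) :=
      fun e => by split_ifs <;> positivity
    linarith [this (ex L), this (-ex L), this (ey L), this (-ey L)]
  nlinarith

/-- the lattice potential of a charge, `(G̃_g c)(x) = Σ_y G̃_g(x − y) c(y)`. [folklore] -/
def pot (g : ℝ) (c : Tor L → ℂ) : Tor L → ℂ := fun x => ∑ y : Tor L, greenW L g (x - y) * c y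

/-- Fourier transform of the Green's function: `Σ_x conj φ_k(x) G̃_g(x − y) = [k ≠ 0] conj φ_k(y)/(ε(k) − g)`. [folklore] -/
theorem ft_greenW (g : ℝ) (k y : Tor L) :
    ∑ x : Tor L, (starRingEnd ℂ) (phase L k x) * greenW L g (x - y)
      = if k = 0 then (0 : ℂ) else (starRingEnd ℂ) (phase L k y) / ((epsT L k - g : ℝ) : ℂ) := by
  have hV : ((L : ℂ) ^ 2) ≠ 0 := pow_ne_zero 2 (by exact_mod_cast (NeZero.ne L))
  unfold greenW
  have h1 : ∀ x : Tor L, (starRingEnd ℂ) (phase L k x)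
        * ((∑ q : Tor L, if q = 0 then (0 : ℂ) else phase L q (x - y) / ((epsT L q - g : ℝ) : ℂ)) / (L : ℂ) ^ 2)
      = (∑ q : Tor L, (starRingEnd ℂ) (phase L k x)
          * (if q = 0 then (0 : ℂ) else phase L q (x - y) / ((epsT L q - g : ℝ) : ℂ))) / (L : ℂ) ^ 2 := by
    intro x
    rw [mul_div_assoc', Finset.mul_sum]
  rw [Finset.sum_congr rfl fun x _ => h1 x, ← Finset.sum_div, Finset.sum_comm]
  have hq : ∀ q : Tor L, ∑ x : Tor L, (starRingEnd ℂ) (phase L k x)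
        * (if q = 0 then (0 : ℂ) else phase L q (x - y) / ((epsT L q - g : ℝ) : ℂ))
      = if q = 0 then (0 : ℂ) else
          ((starRingEnd ℂ) (phase L q y) / ((epsT L q - g : ℝ) : ℂ)) * ∑ x : Tor L, phase L (q - k) x := by
    intro q
    by_cases hq0 : q = 0
    · simp [hq0]
    · simp only [if_neg hq0]
      rw [Finset.mul_sum]
      refine Finset.sum_congr rfl fun x _ => ?_
      rw [conj_phase, conj_phase, sub_eq_add_neg x y, phase_add, sub_eq_add_neg q k, phase_add_left,
        phase_neg_left]
      ring
  rw [Finset.sum_congr rfl fun q _ => hq q]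
  by_cases hk : k = 0
  · subst hk
    rw [if_pos rfl]
    have : ∀ q : Tor L, (if q = 0 then (0 : ℂ) else
        ((starRingEnd ℂ) (phase L q y) / ((epsT L q - g : ℝ) : ℂ)) * ∑ x : Tor L, phase L (q - 0) x) = 0 := by
      intro q
      by_cases hq0 : q = 0
      · simp [hq0]
      · rw [if_neg hq0, sub_zero, sum_phase_right, if_neg hq0, mul_zero]
    rw [Finset.sum_congr rfl fun q _ => this q]
    simp
  · rw [if_neg hk, Finset.sum_eq_single k]
    · rw [if_neg hk, sub_self, sum_phase_right, if_pos rfl]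
      exact mul_div_cancel_right₀ _ hV
    · intro q _ hqk
      by_cases hq0 : q = 0
      · simp [hq0]
      · rw [if_neg hq0, sum_phase_right, if_neg (sub_ne_zero.mpr hqk), mul_zero]
    · intro h; exact absurd (Finset.mem_univ k) h

/-- **Fourier transform of a potential:** `(G̃_g c)^(k) = [k ≠ 0] ĉ(k)/(ε(k) − g)`. [folklore] -/
theorem ft_pot (g : ℝ) (c : Tor L → ℂ) (k : Tor L) :
    ft L (pot L g c) k = if k = 0 then (0 : ℂ) else ft L c k / ((epsT L k - g : ℝ) : ℂ) := by
  unfold ft pot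
  simp_rw [Finset.mul_sum, ← mul_assoc]
  rw [Finset.sum_comm]
  simp_rw [← Finset.sum_mul, ft_greenW]
  by_cases hk : k = 0
  · simp [hk]
  · simp_rw [if_neg hk]
    rw [Finset.sum_div]
    refine Finset.sum_congr rfl fun y _ => ?_
    ring

/-- a potential has zero mean. [folklore] -/
theorem sum_pot (g : ℝ) (c : Tor L → ℂ) : ∑ x : Tor L, pot L g c x = 0 := by
  rw [← ft_zero, ft_pot, if_pos rfl]

/-- **energy of a potential:** `E[G̃c] − g‖G̃c‖² = Re Γ_g(c)` (`g < ε₁`). [folklore] -/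
theorem energy_pot (hL : 2 ≤ L) {g : ℝ} (hg : g < eps1 L) (c : Tor L → ℂ) :
    dirichletW L (pot L g c) - g * ∑ x : Tor L, ‖pot L g c x‖ ^ 2 = (greenQF L g c).re := by
  rw [dirichletW_eq, sum_norm_sq, greenQF_eq, div_V_re, Complex.re_sum, mul_div_assoc', ← sub_div, Finset.mul_sum,
    ← Finset.sum_sub_distrib]
  congr 1
  refine Finset.sum_congr rfl fun k _ => ?_
  rw [ft_pot]
  by_cases hk : k = 0
  · simp [hk]
  · have ha : 0 < epsT L k - g := by have := eps1_le_epsT L hL hk; linarith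
    rw [if_neg hk, if_neg hk, Complex.ofReal_re, norm_div, Complex.norm_real, Real.norm_eq_abs,
      abs_of_pos ha]
    field_simp

/-- ★ **NECESSITY (sharpness of the criterion):** if `TwoHoleGap L g` holds, then for every pair and every charge whose
potential vanishes on the pair, `½(Σ_e‖G̃c(z₁+e)‖² + Σ_e‖G̃c(z₂+e)‖²) ≤ Re Γ_g(c)` — the dual certificate inequality is attained
by potentials, so the finite criterion is EQUIVALENT to the two-hole Poincaré inequality at fixed `L`. [folklore] -/
theorem greenQF_ge_of_twoHoleGap (hL : 2 ≤ L) {g : ℝ} (hg : g < eps1 L) (hGap : TwoHoleGap L g)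
    {z₁ z₂ : Tor L} (hne : z₁ ≠ z₂) (c : Tor L → ℂ) (h1 : pot L g c z₁ = 0) (h2 : pot L g c z₂ = 0) :
    (1 / 2 : ℝ) * (nbr L (pot L g c) z₁ + nbr L (pot L g c) z₂) ≤ (greenQF L g c).re := by
  have hcut : cut L z₁ z₂ (pot L g c) = pot L g c := by
    funext x
    unfold cut
    split_ifs with hx
    · rcases hx with hx | hx
      · rw [hx, h1]
      · rw [hx, h2]
    · rfl
  have hmean : ∑ x : Tor L, (if (x = z₁ ∨ x = z₂) then (0 : ℂ) else pot L g c x) = 0 := by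
    have : ∑ x : Tor L, cut L z₁ z₂ (pot L g c) x = 0 := by rw [hcut, sum_pot]
    exact this
  have h := hGap z₁ z₂ hne (pot L g c) hmean
  rw [guarded_sum_eq L hne, hcut] at h
  have hn : ∑ x : Tor L, (if (x = z₁ ∨ x = z₂) then (0 : ℝ) else ‖pot L g c x‖ ^ 2)
      = ∑ x : Tor L, ‖pot L g c x‖ ^ 2 := by
    refine Finset.sum_congr rfl fun x _ => ?_
    rw [← norm_cut_sq, hcut]
  rw [hn] at h
  have he := energy_pot L hL hg c
  linarith

/-- the potential of a charge carried by the ten slots, read on the ten slots, is the Green matrix acting on the charge. [folklore] -/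
theorem pot_chargeOf (g : ℝ) (z₁ z₂ : Tor L) (w : Fin 5 ⊕ Fin 5 → ℂ) (p : Fin 5 ⊕ Fin 5) :
    pot L g (chargeOf L z₁ z₂ w) (bsPt L z₁ z₂ p) = (greenMat L g z₁ z₂).mulVec w p := by
  unfold pot
  rw [sum_mul_chargeOf]
  rfl

/-- ★ **NECESSITY, matrix form:** under `TwoHoleGap L g`, for every pair and every charge vector `w` on the ten slots whose
potential `G̃_DD w` vanishes at the two centres, `½ Σ_p ‖(G̃_DD w)_p‖² ≤ Re wᴴ G̃_DD w`; with `G̃_DD` invertible this is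
`[(G̃_DD)⁻¹]_{BB} − ½N ⪰ 0`, i.e. exactly the hypothesis of `matrixCert_of_inverse`. [folklore] -/
theorem greenMat_form_ge_of_twoHoleGap (hL : 2 ≤ L) {g : ℝ} (hg : g < eps1 L) (hGap : TwoHoleGap L g)
    {z₁ z₂ : Tor L} (hne : z₁ ≠ z₂) (w : Fin 5 ⊕ Fin 5 → ℂ)
    (h1 : (greenMat L g z₁ z₂).mulVec w (Sum.inl 0) = 0) (h2 : (greenMat L g z₁ z₂).mulVec w (Sum.inr 0) = 0) :
    (1 / 2 : ℝ) * ∑ p : Fin 5 ⊕ Fin 5, ‖(greenMat L g z₁ z₂).mulVec w p‖ ^ 2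
      ≤ (∑ p : Fin 5 ⊕ Fin 5, ∑ q : Fin 5 ⊕ Fin 5, (starRingEnd ℂ) (w p) * greenMat L g z₁ z₂ p q * w q).re := by
  have hp1 : pot L g (chargeOf L z₁ z₂ w) z₁ = 0 := (pot_chargeOf L g z₁ z₂ w (Sum.inl 0)).trans h1
  have hp2 : pot L g (chargeOf L z₁ z₂ w) z₂ = 0 := (pot_chargeOf L g z₁ z₂ w (Sum.inr 0)).trans h2
  have h := greenQF_ge_of_twoHoleGap L hL hg hGap hne (chargeOf L z₁ z₂ w) hp1 hp2
  rw [nbr_add_nbr L hp1 hp2, greenQF_chargeOf] at h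
  have hr : ∀ p : Fin 5 ⊕ Fin 5, restr L z₁ z₂ (pot L g (chargeOf L z₁ z₂ w)) p = (greenMat L g z₁ z₂).mulVec w p :=
    fun p => pot_chargeOf L g z₁ z₂ w p
  simp_rw [hr] at h
  exact h

end TwoHoleBS

end Summit.HubbardSuperconductivity.HubbardSuperconductivity.Theorems.AnisotropyChord.Transfer.Fibre3

end
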